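import Literature.Analysis.Matrix.QuadraticCombesThomas

/-!
# The coercive (and accretive) Combes–Thomas bound: exponential decay of `A⁻¹` for a finite-range `A`

Topic `Literature/Analysis/Matrix`; namespace `Literature.Analysis.Matrix`.  Everything here is
PROVED (no definitions, no named facts).  Companion of `QuadraticCombesThomas` (which treats
`(AᴴA + μ)⁻¹`): here the inverse of `A` ITSELF is localised, with no normality or
self-adjointness assumption, from a lower bound on the smallest singular value (coercive form) or on
the numerical range (accretive form).

Let `ι` be a finite index set with an `ℕ`-valued pseudo-metric `dist`, and `A : Matrix ι ι ℂ` of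
RANGE ONE (`A i j ≠ 0 → dist i j ≤ 1`) whose absolute row and column sums over `{j | dist i j ≠ 0}`
are at most `h`.

* `coercive_combes_thomas` — if `g² Σ|v_i|² ≤ Σ|(Av)_i|²` for all `v` (`σ_min(A) ≥ g > 0`) and
  `θ ≥ 0` satisfies `h(e^θ − 1) ≤ g/2`, then `A` is invertible and
  `|A⁻¹ᵢⱼ| ≤ (2/g) e^{−θ dist(i,j)}`.
* `accretive_combes_thomas` — the same conclusion with `2/m` from `m`-accretivity
  `m Σ|v_i|² ≤ Re Σ conj(v_i) (Av)_i`, `m > 0`, `h(e^θ − 1) ≤ m/2` (accretive ⇒ coercive with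
  `g = m` by Cauchy–Schwarz).  This is the configuration-wise "Vafa–Witten shield" form used for
  lattice Dirac operators at positive bare mass, and the twin of the hopping-expansion locality
  with accretivity replacing `|κ| h < 1`.

Proof of the coercive form ([CombesThomas1973]; [AizenmanWarzel2015, §10.3], without square
roots): fix the column `j`, `x := A⁻¹ e_j`, weights `d_k := e^{θ dist(k,j)}`, `v := d·x`.  Then
`A v = e_j − E v` with the Combes–Thomas perturbation `E_{lk} = A_{lk}(e^{θ(dist(l,j) − dist(k,j))} − 1)`,
whose entries vanish where `dist(l,k) = 0` and are `≤ (e^θ − 1)|A_{lk}|` elsewhere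
(`norm_mul_exp_sub_one_le`, `abs_natDist_sub_natDist_le`), so Schur's test
(`sum_norm_sq_mulVec_le_of_rowSum_le_of_colSum_le`, [HornJohnson2013, §5.6]) gives
`Σ|Ev|² ≤ η² Σ|v|²` with `η = h(e^θ − 1) ≤ g/2`.  With `S := Σ|v|²` the floor gives
`g² S ≤ Σ|Av|² ≤ 2 + 2η² S ≤ 2 + g² S/2`, so `S ≤ 4/g²`, and the single term `d_i² |x_i|² ≤ S`
yields the claim.  Nothing depends on `|ι|`.

This file was extracted from the Summits-side theorem
`Summits/QuantumFields/QCD/Theorems/SpectralDefectExtinctionExtinctionBuildsQCDCleanRefStubCombesThomasWilson.lean`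
(where the coercive form localises the Wilson quark propagator off a certified spectral window) so
that other users (e.g. the accretive Wilson shield at positive bare mass) can import it from
`Literature`.

References: Combes–Thomas, Comm. Math. Phys. 34 (1973) 251 [CombesThomas1973]; Aizenman–Warzel,
*Random Operators*, GSM 168 (2015), §10.3 [AizenmanWarzel2015]; Chulaevsky–Suhov (2014), Thm 2.3.3
(accretive/resolvent form) [ChulaevskySuhov2014].
-/

noncomputable section

open Finset
open scoped Matrix ComplexConjugate

namespace Literature.Analysis.Matrix

section CombesThomasInverse

variable {ι : Type*} [Fintype ι] [DecidableEq ι]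

/-- **The coercive Combes–Thomas bound** (Combes–Thomas 1973; Aizenman–Warzel §10.3, coercive
form, no self-adjointness).  Let `dist` be an `ℕ`-valued pseudo-metric on the finite index set
`ι` and `A : Matrix ι ι ℂ` a range-one matrix (`A i j ≠ 0 → dist i j ≤ 1`) whose absolute row and
column sums over `{dist ≠ 0}` are at most `h`; assume the coercivity floor
`g² Σ|v_i|² ≤ Σ|(Av)_i|²` for all `v` with `0 < g`, and let `θ ≥ 0` satisfy
`h(e^θ − 1) ≤ g/2`.  Then `A` is invertible and `|A⁻¹ᵢⱼ| ≤ (2/g) e^{−θ dist(i,j)}` for all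
`i, j`. [cite: AizenmanWarzel2015, §10.3 (Combes–Thomas estimate)] -/
theorem coercive_combes_thomas (dist : ι → ι → ℕ) (hd0 : ∀ i, dist i i = 0)
    (hds : ∀ i j, dist i j = dist j i) (hdt : ∀ i j k, dist i k ≤ dist i j + dist j k)
    (A : Matrix ι ι ℂ) (hrange : ∀ i j, A i j ≠ 0 → dist i j ≤ 1) (h : ℝ)
    (hrow : ∀ i, ∑ j ∈ univ.filter (fun j => dist i j ≠ 0), ‖A i j‖ ≤ h)
    (hcol : ∀ j, ∑ i ∈ univ.filter (fun i => dist i j ≠ 0), ‖A i j‖ ≤ h)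
    (g θ : ℝ) (hg : 0 < g) (hθ : 0 ≤ θ)
    (hfloor : ∀ v : ι → ℂ, g ^ 2 * ∑ i, ‖v i‖ ^ 2 ≤ ∑ i, ‖(A *ᵥ v) i‖ ^ 2)
    (hη : h * (Real.exp θ - 1) ≤ g / 2) :
    IsUnit A.det ∧ ∀ i j, ‖A⁻¹ i j‖ ≤ 2 / g * Real.exp (-(θ * dist i j)) := by
  -- (1) `A` is injective by the floor, hence invertible
  have hdet : IsUnit A.det := by
    rw [isUnit_iff_ne_zero, Ne, ← Matrix.exists_mulVec_eq_zero_iff]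
    rintro ⟨x, hx, hAx⟩
    obtain ⟨j₀, hj₀⟩ := Function.ne_iff.mp hx
    have h2 : ‖x j₀‖ ^ 2 ≤ ∑ i, ‖x i‖ ^ 2 :=
      Finset.single_le_sum (f := fun i => ‖x i‖ ^ 2) (fun i _ => by positivity) (mem_univ j₀)
    have h3 : 0 < ‖x j₀‖ ^ 2 := by positivity
    have h4 : ∑ i, ‖(A *ᵥ x) i‖ ^ 2 = 0 := by simp [hAx]
    have h5 := hfloor x
    rw [h4] at h5
    have h6 : 0 < g ^ 2 * ∑ i, ‖x i‖ ^ 2 := mul_pos (pow_pos hg 2) (h3.trans_le h2)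
    linarith
  refine ⟨hdet, fun i j => ?_⟩
  -- (2) the column `j` of `A⁻¹`
  obtain ⟨x, hx⟩ : ∃ x : ι → ℂ, x = A⁻¹ *ᵥ Pi.single j 1 := ⟨_, rfl⟩
  have hxK : ∀ k, x k = A⁻¹ k j := fun k => by
    rw [hx, Matrix.mulVec_single_one, Matrix.col_apply]
  have hAx : A *ᵥ x = Pi.single j 1 := by
    rw [hx, Matrix.mulVec_mulVec, Matrix.mul_nonsing_inv _ hdet, Matrix.one_mulVec]
  -- (3) the weights, the weighted column and the Combes–Thomas perturbation
  set η : ℝ := h * (Real.exp θ - 1) with hηdef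
  set d : ι → ℝ := fun k => Real.exp (θ * dist k j) with hd
  set v : ι → ℂ := fun k => (d k : ℂ) * x k with hv
  set Ep : Matrix ι ι ℂ := Matrix.of fun l k =>
    A l k * ((Real.exp (θ * ((dist l j : ℝ) - dist k j)) - 1 : ℝ) : ℂ) with hEp
  set S : ℝ := ∑ k, ‖v k‖ ^ 2 with hS
  have hexp0 : 0 ≤ Real.exp θ - 1 := by linarith [Real.add_one_le_exp θ]
  have hh0 : 0 ≤ h := (Finset.sum_nonneg fun j _ => norm_nonneg _).trans (hrow j)
  have hη0 : 0 ≤ η := mul_nonneg hh0 hexp0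
  have hS0 : 0 ≤ S := Finset.sum_nonneg fun k _ => by positivity
  -- the algebra: `(A v)_l + (E v)_l = d_l (A x)_l`
  have hpl : ∀ l, (A *ᵥ v) l + (Ep *ᵥ v) l = (d l : ℂ) * (A *ᵥ x) l := by
    intro l
    simp only [hEp, hv, Matrix.mulVec, dotProduct, Matrix.of_apply]
    rw [← Finset.sum_add_distrib, Finset.mul_sum]
    refine Finset.sum_congr rfl fun k _ => ?_
    have hc : Real.exp (θ * ((dist l j : ℝ) - dist k j)) * d k = d l := by
      simp only [hd]; rw [← Real.exp_add]; ring_nf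
    have hc' : ((Real.exp (θ * ((dist l j : ℝ) - dist k j)) : ℝ) : ℂ) * (d k : ℂ) =
        (d l : ℂ) := by exact_mod_cast hc
    simp only [Complex.ofReal_sub, Complex.ofReal_one]
    linear_combination (A l k * x k) * hc'
  have hdj : d j = 1 := by simp [hd, hd0]
  -- hence `A v = e_j − E v` (`d_j = 1`)
  have hAv : ∀ l, (A *ᵥ v) l = (Pi.single j 1 : ι → ℂ) l - (Ep *ᵥ v) l := by
    intro l
    rw [eq_sub_iff_add_eq, hpl l, hAx]
    by_cases hl : l = j
    · subst hl
      rw [hdj, Complex.ofReal_one, one_mul]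
    · rw [Pi.single_eq_of_ne hl, mul_zero]
  -- (4) Schur's test: `Σ|(E v)_l|² ≤ η² S`
  have hEp_le : ∀ l k, ‖Ep l k‖ ≤ (Real.exp θ - 1) * (if dist l k ≠ 0 then ‖A l k‖ else 0) := by
    intro l k
    simp only [hEp, Matrix.of_apply]
    exact norm_mul_exp_sub_one_le dist A hrange hθ l k
      (abs_natDist_sub_natDist_le dist hds hdt l k j)
  have hsum : ∀ (f₁ f₂ : ι → ℝ) (nz : ι → Prop) [DecidablePred nz],
      (∀ k, f₁ k ≤ (Real.exp θ - 1) * (if nz k then f₂ k else 0)) →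
        ∑ k ∈ univ.filter nz, f₂ k ≤ h → ∑ k, f₁ k ≤ η := by
    intro f₁ f₂ nz _ hf hb
    calc ∑ k, f₁ k ≤ ∑ k, (Real.exp θ - 1) * (if nz k then f₂ k else 0) :=
          sum_le_sum fun k _ => hf k
      _ = (Real.exp θ - 1) * ∑ k ∈ univ.filter nz, f₂ k := by rw [← mul_sum, sum_filter]
      _ ≤ η := by rw [hηdef, mul_comm h]; exact mul_le_mul_of_nonneg_left hb hexp0
  have hSp : ∑ l, ‖(Ep *ᵥ v) l‖ ^ 2 ≤ η ^ 2 * S := by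
    simpa only [← pow_two] using sum_norm_sq_mulVec_le_of_rowSum_le_of_colSum_le Ep hη0
      (fun l => hsum _ _ _ (fun k => hEp_le l k) (hrow l))
      (fun k => hsum _ _ _ (fun l => hEp_le l k) (hcol k)) v
  -- (5) `g² S ≤ Σ|(A v)_l|² ≤ 2 + 2 η² S ≤ 2 + g² S / 2`, hence `g² S ≤ 4`
  have hpt : ∀ l, ‖(A *ᵥ v) l‖ ^ 2 ≤
      2 * ‖(Pi.single j 1 : ι → ℂ) l‖ ^ 2 + 2 * ‖(Ep *ᵥ v) l‖ ^ 2 := by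
    intro l
    rw [hAv l]
    have h1 := norm_sub_le ((Pi.single j 1 : ι → ℂ) l) ((Ep *ᵥ v) l)
    have h2 := norm_nonneg ((Pi.single j 1 : ι → ℂ) l - (Ep *ᵥ v) l)
    nlinarith [sq_nonneg (‖(Pi.single j 1 : ι → ℂ) l‖ - ‖(Ep *ᵥ v) l‖),
      norm_nonneg ((Pi.single j 1 : ι → ℂ) l), norm_nonneg ((Ep *ᵥ v) l)]
  have hsingle : ∑ l, ‖(Pi.single j 1 : ι → ℂ) l‖ ^ 2 = 1 := by
    rw [Finset.sum_eq_single j (fun l _ hl => by simp [Pi.single_eq_of_ne hl]) (by simp)]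
    simp
  have hAvS : ∑ l, ‖(A *ᵥ v) l‖ ^ 2 ≤ 2 + 2 * (η ^ 2 * S) := by
    calc ∑ l, ‖(A *ᵥ v) l‖ ^ 2
        ≤ ∑ l, (2 * ‖(Pi.single j 1 : ι → ℂ) l‖ ^ 2 + 2 * ‖(Ep *ᵥ v) l‖ ^ 2) :=
          Finset.sum_le_sum fun l _ => hpt l
      _ = 2 * ∑ l, ‖(Pi.single j 1 : ι → ℂ) l‖ ^ 2 + 2 * ∑ l, ‖(Ep *ᵥ v) l‖ ^ 2 := by
          rw [Finset.sum_add_distrib, Finset.mul_sum, Finset.mul_sum]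
      _ ≤ 2 + 2 * (η ^ 2 * S) := by rw [hsingle, mul_one]; linarith [hSp]
  have hgS : g ^ 2 * S ≤ 4 := by
    have h1 : g ^ 2 * S ≤ 2 + 2 * (η ^ 2 * S) := (hfloor v).trans hAvS
    have h2 : η ^ 2 ≤ g ^ 2 / 4 := by nlinarith [hη, hη0, hg]
    have h3 : η ^ 2 * S ≤ g ^ 2 / 4 * S := mul_le_mul_of_nonneg_right h2 hS0
    linarith
  -- (6) the single term `d_i² |x_i|² ≤ S ≤ 4 / g²`
  have hvi : ‖v i‖ ^ 2 = d i ^ 2 * ‖x i‖ ^ 2 := by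
    simp only [hv]
    rw [norm_mul, Complex.norm_real, Real.norm_eq_abs, abs_of_pos (Real.exp_pos _), mul_pow]
  have hiS : ‖v i‖ ^ 2 ≤ S :=
    Finset.single_le_sum (f := fun k => ‖v k‖ ^ 2) (fun k _ => by positivity) (mem_univ i)
  have h4 : (d i * ‖x i‖) ^ 2 ≤ (2 / g) ^ 2 := by
    rw [mul_pow, ← hvi, div_pow, le_div_iff₀ (by positivity)]
    calc ‖v i‖ ^ 2 * g ^ 2 ≤ S * g ^ 2 := mul_le_mul_of_nonneg_right hiS (sq_nonneg g)
      _ ≤ 2 ^ 2 := by linarith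
  have h5 : d i * ‖x i‖ ≤ 2 / g :=
    (pow_le_pow_iff_left₀ (by positivity) (by positivity) two_ne_zero).mp h4
  rw [← hxK i, Real.exp_neg, ← div_eq_mul_inv, le_div_iff₀ (Real.exp_pos _), mul_comm]
  exact h5

/-- **The accretive Combes–Thomas bound** (the "Vafa–Witten shield" form; Chulaevsky–Suhov
Thm 2.3.3 for resolvents).  Under the geometric hypotheses of `coercive_combes_thomas` (range one,
off-diagonal absolute row/column sums over `{dist ≠ 0}` at most `h`), if `A` is `m`-ACCRETIVE,
`m Σ|v_i|² ≤ Re Σᵢ conj(v_i) (Av)_i` for all `v` with `m > 0`, and `θ ≥ 0` satisfies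
`h(e^θ − 1) ≤ m/2`, then `A` is invertible and `|A⁻¹ᵢⱼ| ≤ (2/m) e^{−θ dist(i,j)}`.
Proof: accretivity and Cauchy–Schwarz give the coercivity floor `m² Σ|v|² ≤ Σ|Av|²`; apply
`coercive_combes_thomas` with `g = m`. [cite: AizenmanWarzel2015, §10.3 (Combes–Thomas estimate)] -/
theorem accretive_combes_thomas (dist : ι → ι → ℕ) (hd0 : ∀ i, dist i i = 0)
    (hds : ∀ i j, dist i j = dist j i) (hdt : ∀ i j k, dist i k ≤ dist i j + dist j k)
    (A : Matrix ι ι ℂ) (hrange : ∀ i j, A i j ≠ 0 → dist i j ≤ 1) (h : ℝ)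
    (hrow : ∀ i, ∑ j ∈ univ.filter (fun j => dist i j ≠ 0), ‖A i j‖ ≤ h)
    (hcol : ∀ j, ∑ i ∈ univ.filter (fun i => dist i j ≠ 0), ‖A i j‖ ≤ h)
    (m θ : ℝ) (hm : 0 < m) (hθ : 0 ≤ θ)
    (hacc : ∀ v : ι → ℂ, m * ∑ i, ‖v i‖ ^ 2 ≤ (∑ i, star (v i) * (A *ᵥ v) i).re)
    (hη : h * (Real.exp θ - 1) ≤ m / 2) :
    IsUnit A.det ∧ ∀ i j, ‖A⁻¹ i j‖ ≤ 2 / m * Real.exp (-(θ * dist i j)) := by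
  refine coercive_combes_thomas dist hd0 hds hdt A hrange h hrow hcol m θ hm hθ (fun v => ?_) hη
  -- accretive ⇒ coercive: `m S ≤ Re⟨v, Av⟩ ≤ √S √T`, hence `m² S ≤ T`
  set S : ℝ := ∑ i, ‖v i‖ ^ 2 with hS
  set T : ℝ := ∑ i, ‖(A *ᵥ v) i‖ ^ 2 with hT
  have hS0 : 0 ≤ S := Finset.sum_nonneg fun i _ => by positivity
  have hT0 : 0 ≤ T := Finset.sum_nonneg fun i _ => by positivity
  have h1 : m * S ≤ Real.sqrt S * Real.sqrt T := by
    calc m * S ≤ (∑ i, star (v i) * (A *ᵥ v) i).re := hacc v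
      _ ≤ ‖∑ i, star (v i) * (A *ᵥ v) i‖ := Complex.re_le_norm _
      _ = ‖star v ⬝ᵥ (A *ᵥ v)‖ := by rfl
      _ ≤ Real.sqrt S * Real.sqrt T := norm_star_dotProduct_le_sqrt_mul_sqrt v (A *ᵥ v)
  have h2 : (m * S) ^ 2 ≤ S * T := by
    have h3 : 0 ≤ m * S := mul_nonneg hm.le hS0
    calc (m * S) ^ 2 ≤ (Real.sqrt S * Real.sqrt T) ^ 2 := pow_le_pow_left₀ h3 h1 2
      _ = S * T := by rw [mul_pow, Real.sq_sqrt hS0, Real.sq_sqrt hT0]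
  by_cases hS00 : S = 0
  · rw [hS00, mul_zero]; exact hT0
  · have hSpos : 0 < S := lt_of_le_of_ne hS0 (Ne.symm hS00)
    have h4 : m ^ 2 * S * S ≤ T * S := by nlinarith
    exact le_of_mul_le_mul_right h4 hSpos

end CombesThomasInverse

end Literature.Analysis.Matrix
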